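import Literature.Analysis.OperatorTheory.Enflo2023.Vy
import Literature.Analysis.OperatorTheory.Enflo2023.Basic
import Literature.Analysis.InnerProduct.WeakSubsequence
import HarnessLib

/-!
# Enflo 2023, v2 pp.10–11: Lemma 2 (the `γ(εθ)` renormalisation) and Lemmas 3–5, typed

Source under adjudication: Per H. Enflo, *On the invariant subspace problem in Hilbert spaces*, arXiv:2305.15442 (v1
2023, v2 2024), bib key `Enflo2023` — a CLAIMED proof of the invariant subspace problem for operators on a separable
Hilbert space.  This file is part of the kernel-tight typing of the manuscript by the b2b-enflo repair cell
(formaliser 1, Part A: v2 eq. (1)–(27), the set-up, the constructions `V_y`, `ℓ'`, `[ ]x₀`, Lemma 1 and Case I/II of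
the main step).  It records what FOLLOWS (proved implications from the manuscript's displayed hypotheses) and, where a
step does not follow, the typed inference together with its refutation.  NOTHING here asserts that the manuscript's
main theorem holds; no declaration concludes the invariant subspace problem for an arbitrary operator.  Value
(BLOCK-2b): theorems / refutations of typed inferences about a text — not progress on the problem.

WHAT THIS FILE TYPES (v2 pp.10–11; lines 322–386 of the arXiv v2 LaTeX source).  The situation of Lemma 2: `y` (the
paper's `y₁' = ℓ(T)y`) with `⟨T^j y, x₀ − y⟩` small for every `j ≥ 0` (this is (9) for the end point of a minimal
move, `Vy.eq9_pow`; the paper writes `≤ εθ`, here `t`), `‖y‖ ≤ 1`, `‖x₀ − y‖ ≤ 1`, and `c ∈ ℓ²` THE norm-minimal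
solution of problem (1) for `V_y` at the radius `‖x₀ − y‖` (the paper's `Σ_j c_{1j}T^j y₁'`, `c_{10} = 1 − d`).
* Part 1 — the constants of the proof of Lemma 2, reproduced: `K = 10²⁰`, `m = [1 + log_K(1/εθ)]`
  (`mIdx`, `pow_mIdx_le`), the first display `‖T^{m+r}y‖ ≤ εθ·K^{-r}` (`norm_pow_mIdx_add_le`), the second
  display REPAIRED: `|⟨Σ_j b_j T^j y, x₀ − y⟩| ≤ R·(m + 2)·εθ` for `|b_j| ≤ R` (`norm_inner_V_le`; the printed
  constant `2 log_K(1/εθ)` is contradicted by `b = e₀` as soon as `εθ > 10⁻¹⁰`, `printed_pairing_bound_fails`),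
  the coefficient bounds from minimality `‖c‖ ≤ 1`, `Σ_{j≥1}|c_j|² ≤ 2|d|` (`norm_L_sq_le_two_mul`), and the
  expansion of `‖x₀ − V_y c‖²` giving `‖y − V_y c‖² ≤ 4(m+2)εθ` (`norm_sub_V_sq_le`) — this is Lemma 4 with an
  EXPLICIT bound; the printed chain `h(|d|) ≤ 2[log_K(1/εθ)]^{1/2}` drops the factor `εθ` under the root (with
  it the bound tends to `0`, without it it exceeds `0.89` on the whole range `εθ ≤ 10⁻⁴`, `printed_root_ge`).
* Part 2 — the NON-CONSTRUCTIVE step, v2 p.11 "We first observe that h(|d|) > 0. Otherwise, we could find a sequence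
  `y'_{1n}`, `⟨y'_{1n}, u₀⟩ > 1/100`, weakly convergent, such that for `w-lim y'_{1n} = y'_{1∞}` we have
  `d y'_{1∞} = Σ_{j≥1} c_j T^j y'_{1∞}` which contradicts that `y'_{1∞}` is cyclic and `T` is not invertible":
  `hFun T u₀ ρ` = the infimum of `‖V_y b‖ = ‖b₀ y + Σ_{j≥1} b_j T^j y‖` over admissible `y` (`‖y‖ ≤ 1`,
  `Re⟨y, u₀⟩ ≥ 3/1000` — the weakly closed consequence of the type-1 cone condition and `‖y‖ ≥ 0.3`) and `b ∈ ℓ²`,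
  `‖b‖ ≤ 2`, `|b₀| ≥ ρ`; **`hFun_pos_or`**: for `T` not surjective (v2 p.1, `R(T) ≠ H`) and `0 < ρ ≤ 2`, EITHER
  `hFun ρ > 0` OR `T` has a non-trivial closed invariant subspace (the weak limit is non-cyclic) — weak subsequences
  (`Literature.Analysis.InnerProduct.exists_strictMono_tendsto_inner_of_norm_le`), Tannery's theorem, and
  `Σ_j b_j T^j` vanishing on a cyclic vector `⇒ b₀·I = −T·q(T) ⇒ T` surjective.
* Part 3 — `γ`: `gammaEps T u₀ εθ := 2·sup{ρ ≤ 2 : hFun ρ ≤ 2[(m+2)εθ]^{1/2}} + 4(m+2)εθ` (`noncomputable`: an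
  infimum over all admissible vectors — the function `γ(εθ, u₀, T)` has no closed form, which is the source of
  every later unverifiable "`γ(εθ)` of smaller order than `δ_k`", v2 p.8); **Lemma 2** `|c₀|² ≥ 1 − γ(εθ)` and
  `Σ_{j≥1}|c_j|² ≤ γ(εθ)` (`lemma2_coeff`), **Lemma 4** `‖y − V_y c‖ ≤ γ^{1/2}` (`lemma4_move`), **Lemma 3 = Lemma 5**
  (verbatim the same display in the text) `Re⟨V_y c, x₀ − V_y c⟩ ≤ 3γ^{1/2}` (`lemma3_etheta`), and
  **`γ(εθ) → 0` as `εθ → 0⁺` OR `T` has a non-trivial closed invariant subspace** (`gammaEps_tendsto_zero_or`);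
  the shape of (22) for the renormalised coefficients once `γ ≤ 1/101` (`lemma2_coeff_ratio`).
RECORD.  The conclusions of Lemmas 2–5 FOLLOW from the displayed hypotheses with the two constant slips repaired
(`2 log_K(1/εθ)` ↦ `m + 2`; the factor `εθ` restored under the root), for the coefficients `c_{1j}` relative to
`y₁'` (the text's `a_j` relative to `y₁ = s·y₁'` differ by the undetermined scalar `s` of the garbled first line of
Lemma 2; the proof bounds `d = 1 − c_{10}` only).  What does NOT come with the text is any RATE: `γ = γ(εθ, u₀, T)`
is an infimum over all admissible vectors, obtained by weak compactness and the dichotomy "or a non-cyclic vector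
appears"; it is not computable from `εθ` and `K`, so every later comparison "`γ(εθ)` of smaller order than `δ_k`"
(v2 p.8, l.-3) is an assumption on `T`, not a consequence of Lemma 2 (STEPS.md rows A18/A23 of the cell record).
Conventions: Mathlib's `⟪u, v⟫_ℂ` is conjugate-linear in `u`; the paper's `⟨u, v⟩` is `⟪v, u⟫_ℂ`.  No new axioms.
-/

open scoped InnerProductSpace ENNReal
open Filter Topology RCLike

noncomputable section

namespace Literature.Analysis.OperatorTheory.Enflo2023

variable {H : Type*} [NormedAddCommGroup H] [InnerProductSpace ℂ H] [CompleteSpace H]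

namespace Vy

/-! ### `V_y b` as a function of the vector `y`: the operator `b(T) = Σ_j b_j T^j` -/

/-- `V_{y+y'} b = V_y b + V_{y'} b`. [cite: Enflo2023, v2 p.2, eq. (2)] -/
lemma V_add_vec (T : H →L[ℂ] H) (hT : ‖T‖ < 1) (y y' : H) (b : ℓ2) :
    V T hT (y + y') b = V T hT y b + V T hT y' b := by
  simp only [V_apply, map_add, smul_add]
  exact (summable_terms T hT y b).tsum_add (summable_terms T hT y' b)

/-- `V_{c y} b = c V_y b`. [cite: Enflo2023, v2 p.2, eq. (2)] -/
lemma V_smul_vec (T : H →L[ℂ] H) (hT : ‖T‖ < 1) (c : ℂ) (y : H) (b : ℓ2) :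
    V T hT (c • y) b = c • V T hT y b := by
  simp only [V_apply, map_smul]
  rw [← (summable_terms T hT y b).tsum_const_smul c]
  exact tsum_congr fun j => smul_comm _ _ _

/-- `V_{Ty} b = T (V_y b)`: the coefficient operator commutes with `T`. [cite: Enflo2023, v2 p.2, eq. (2)] -/
lemma V_apply_T (T : H →L[ℂ] H) (hT : ‖T‖ < 1) (y : H) (b : ℓ2) :
    V T hT (T y) b = T (V T hT y b) := by
  rw [V_apply, V_apply, ContinuousLinearMap.map_tsum T (summable_terms T hT y b)]
  refine tsum_congr fun j => ?_
  rw [ContinuousLinearMap.map_smul]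
  congr 1
  rw [← mul_apply_eq_comp, ← mul_apply_eq_comp, ← pow_succ, ← pow_succ']

/-- `‖V_y b‖ ≤ ‖y‖(1 − ‖T‖²)^{-1/2}‖b‖`. [cite: Enflo2023, v2 p.2, eq. (2)] -/
lemma norm_V_apply_le (T : H →L[ℂ] H) (hT : ‖T‖ < 1) (y : H) (b : ℓ2) :
    ‖V T hT y b‖ ≤ ‖y‖ * Real.sqrt (1 / (1 - ‖T‖ ^ 2)) * ‖b‖ :=
  (V T hT y).le_of_opNorm_le (norm_V_le T hT y) b

/-- **The operator `b(T) = Σ_j b_j T^j`** for `b ∈ ℓ²` (`‖T‖ < 1`), defined pointwise by `v ↦ V_v b`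
(the paper's `d·I − Σ_{j≥1} c_j T^j = d·I − T q(T)` of v2 p.11 is `b(T)` with `b = (d, −c₁, −c₂, …)`). [cite: Enflo2023, v2 p.11, proof of Lemma 2] -/
def Vop (T : H →L[ℂ] H) (hT : ‖T‖ < 1) (b : ℓ2) : H →L[ℂ] H :=
  LinearMap.mkContinuous
    { toFun := fun v => V T hT v b
      map_add' := fun v v' => V_add_vec T hT v v' b
      map_smul' := fun c v => V_smul_vec T hT c v b }
    (Real.sqrt (1 / (1 - ‖T‖ ^ 2)) * ‖b‖)
    (fun v => by
      calc ‖V T hT v b‖ ≤ ‖v‖ * Real.sqrt (1 / (1 - ‖T‖ ^ 2)) * ‖b‖ := norm_V_apply_le T hT v b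
        _ = Real.sqrt (1 / (1 - ‖T‖ ^ 2)) * ‖b‖ * ‖v‖ := by ring)

/-- Unfolding `Vop`: `b(T) v = V_v b = Σ_j b_j T^j v`. [cite: Enflo2023, v2 p.11, proof of Lemma 2] -/
@[simp] lemma Vop_apply (T : H →L[ℂ] H) (hT : ‖T‖ < 1) (b : ℓ2) (v : H) : Vop T hT b v = V T hT v b := rfl

/-- `b(T)` commutes with every power of `T`. [cite: Enflo2023, v2 p.11, proof of Lemma 2] -/
lemma Vop_apply_pow (T : H →L[ℂ] H) (hT : ‖T‖ < 1) (b : ℓ2) (v : H) (j : ℕ) :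
    Vop T hT b ((T ^ j) v) = (T ^ j) (Vop T hT b v) := by
  induction j with
  | zero => simp
  | succ j ih =>
      rw [pow_succ', mul_apply_eq_comp, Vop_apply, V_apply_T, ← Vop_apply, ih, mul_apply_eq_comp]

/-- If `b(T) v = 0` then `b(T)` vanishes on the whole orbit closure of `v` (kernel closed and `T`-invariant). [cite: Enflo2023, v2 p.11, proof of Lemma 2] -/
lemma orbitClosure_le_ker_Vop (T : H →L[ℂ] H) (hT : ‖T‖ < 1) (b : ℓ2) {v : H} (hv : Vop T hT b v = 0) :
    orbitClosure T v ≤ LinearMap.ker ((Vop T hT b : H →L[ℂ] H) : H →ₗ[ℂ] H) := by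
  refine Submodule.topologicalClosure_minimal _ ?_ (ContinuousLinearMap.isClosed_ker _)
  rw [Submodule.span_le]
  rintro _ ⟨j, rfl⟩
  simp only [SetLike.mem_coe, LinearMap.mem_ker, ContinuousLinearMap.coe_coe]
  rw [Vop_apply_pow, hv, map_zero]

/-- The dichotomy behind "contradicts that `y'_{1∞}` is cyclic": if `b(T) v = 0` with `v ≠ 0`, then either `v` is
non-cyclic for `T`, or `b(T) = 0` identically. [cite: Enflo2023, v2 p.11, proof of Lemma 2] -/
lemma isNonCyclic_or_Vop_eq_zero (T : H →L[ℂ] H) (hT : ‖T‖ < 1) (b : ℓ2) {v : H}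
    (hv : Vop T hT b v = 0) : IsNonCyclic T v ∨ Vop T hT b = 0 := by
  by_cases hc : IsNonCyclic T v
  · exact Or.inl hc
  · right
    have htop : orbitClosure T v = ⊤ := not_not.1 hc
    ext x
    have hx : x ∈ LinearMap.ker ((Vop T hT b : H →L[ℂ] H) : H →ₗ[ℂ] H) :=
      orbitClosure_le_ker_Vop T hT b hv (htop ▸ Submodule.mem_top)
    simpa using hx

/-- "… and `T` is not invertible": if `b(T) = 0` with `b₀ ≠ 0` then `b₀ v = −T(V_v(Lb))` for every `v`, so `T` is
surjective. [cite: Enflo2023, v2 p.11, proof of Lemma 2] -/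
lemma surjective_of_Vop_eq_zero (T : H →L[ℂ] H) (hT : ‖T‖ < 1) (b : ℓ2) (hb0 : b 0 ≠ 0)
    (h : Vop T hT b = 0) : Function.Surjective T := by
  intro x
  have hx : V T hT x b = 0 := by
    have := congrArg (fun A : H →L[ℂ] H => A x) h
    simpa using this
  rw [V_decomp] at hx
  have hx' : T (V T hT x (L b)) = -(b 0 • x) := eq_neg_of_add_eq_zero_right hx
  refine ⟨-((b 0)⁻¹ • V T hT x (L b)), ?_⟩
  rw [map_neg, ContinuousLinearMap.map_smul, hx', smul_neg, neg_neg, smul_smul, inv_mul_cancel₀ hb0, one_smul]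

/-- `⟪z, V_y b⟫ = Σ_j b_j ⟪z, T^j y⟫` (pairing a convergent series termwise). [cite: Enflo2023, v2 p.2, eq. (2)–(3)] -/
lemma inner_V_right (T : H →L[ℂ] H) (hT : ‖T‖ < 1) (y z : H) (b : ℓ2) :
    ⟪z, V T hT y b⟫_ℂ = ∑' j, b j * ⟪z, (T ^ j) y⟫_ℂ := by
  rw [V_apply, ← innerSL_apply_apply (𝕜 := ℂ), ContinuousLinearMap.map_tsum _ (summable_terms T hT y b)]
  refine tsum_congr fun j => ?_
  rw [innerSL_apply_apply, inner_smul_right]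

omit [CompleteSpace H] in
/-- Termwise bound `|b_j ⟪z, T^j y⟫| ≤ ‖b‖·‖z‖·‖T‖^j·‖y‖`. [folklore] -/
lemma norm_coord_mul_inner_le (T : H →L[ℂ] H) (y z : H) (b : ℓ2) (j : ℕ) :
    ‖b j * ⟪z, (T ^ j) y⟫_ℂ‖ ≤ ‖b‖ * (‖z‖ * (‖T‖ ^ j * ‖y‖)) := by
  rw [norm_mul]
  refine mul_le_mul (lp.norm_apply_le_norm (by norm_num) b j) ?_ (norm_nonneg _) (norm_nonneg _)
  exact (norm_inner_le_norm _ _).trans (mul_le_mul_of_nonneg_left (norm_pow_apply_le T j y) (norm_nonneg _))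

end Vy

namespace Lemma2

open Vy

/-! ## Part 2 — the function `h` of v2 p.11 and its positivity (the non-constructive step) -/

/-- Admissible vectors for the infimum `h`: `‖y‖ ≤ 1` and `Re⟨y, u₀⟩ ≥ 3/1000` — the weakly closed part of what the
text knows about `y₁'` (`‖y₁'‖ ≤ 1`; type-1 cone `Re⟨y₁', u₀⟩ ≥ ‖y₁'‖/100`, v2 p.7 (19); `‖y₁'‖ ≥ 0.3` from
`‖x₀‖ = 1`, `‖x₀ − y₁'‖ ≤ 0.7`); the text's "⟨y'_{1n}, u₀⟩ > 1/100". [cite: Enflo2023, v2 p.11, proof of Lemma 2] -/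
def Adm (u₀ : H) : Set H := {y | ‖y‖ ≤ 1 ∧ (3 / 1000 : ℝ) ≤ (⟪u₀, y⟫_ℂ).re}

/-- The set of values `‖V_y b‖ = ‖b₀ y + Σ_{j≥1} b_j T^j y‖` over admissible `y`, `‖b‖_{ℓ²} ≤ 2`, `|b₀| ≥ ρ`
(the text's `‖d y₁' − Σ_{j≥1} c_j T^j y₁'‖`, `|c_j| ≤ 1`, `|d| = ρ`; the `ℓ²`-ball of radius `2` contains every
coefficient vector the proof applies `h` to, see `hFun_le_norm_sub_V`). [cite: Enflo2023, v2 p.11, proof of Lemma 2] -/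
def hSet (T : H →L[ℂ] H) (hT : ‖T‖ < 1) (u₀ : H) (ρ : ℝ) : Set ℝ :=
  {r | ∃ y ∈ Adm u₀, ∃ b : ℓ2, ‖b‖ ≤ 2 ∧ ρ ≤ ‖b 0‖ ∧ r = ‖V T hT y b‖}

/-- **The paper's `h`** (as a function of `ρ = |d|`, for fixed `T`, `u₀`): the infimum of `hSet`. [cite: Enflo2023, v2 p.11, proof of Lemma 2] -/
def hFun (T : H →L[ℂ] H) (hT : ‖T‖ < 1) (u₀ : H) (ρ : ℝ) : ℝ := sInf (hSet T hT u₀ ρ)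

/-- Every element of `hSet` is a norm, hence `≥ 0`. [cite: Enflo2023, v2 p.11, proof of Lemma 2] -/
lemma hSet_nonneg (T : H →L[ℂ] H) (hT : ‖T‖ < 1) (u₀ : H) (ρ : ℝ) :
    ∀ r ∈ hSet T hT u₀ ρ, 0 ≤ r := by
  rintro r ⟨y, -, b, -, -, rfl⟩; exact norm_nonneg _

/-- `h ≥ 0`. [cite: Enflo2023, v2 p.11, proof of Lemma 2] -/
lemma hFun_nonneg (T : H →L[ℂ] H) (hT : ‖T‖ < 1) (u₀ : H) (ρ : ℝ) : 0 ≤ hFun T hT u₀ ρ :=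
  Real.sInf_nonneg (hSet_nonneg T hT u₀ ρ)

/-- `u₀` itself (a unit vector) with `b = 2e₀` is admissible: `hSet ρ` is non-empty for `ρ ≤ 2`. [cite: Enflo2023, v2 p.11, proof of Lemma 2] -/
lemma hSet_nonempty (T : H →L[ℂ] H) (hT : ‖T‖ < 1) {u₀ : H} (hu₀ : ‖u₀‖ = 1) {ρ : ℝ} (hρ : ρ ≤ 2) :
    (hSet T hT u₀ ρ).Nonempty := by
  refine ⟨_, u₀, ⟨hu₀.le, ?_⟩, (2 : ℂ) • lp.single 2 0 (1 : ℂ), ?_, ?_, rfl⟩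
  · have : (⟪u₀, u₀⟫_ℂ).re = ‖u₀‖ ^ 2 := by rw [inner_self_eq_norm_sq_to_K]; norm_cast
    rw [this, hu₀]; norm_num
  · rw [norm_smul, lp.norm_single (by norm_num : (0 : ℝ≥0∞) < 2), norm_one, mul_one]; simp
  · simp only [lp.coeFn_smul, Pi.smul_apply, lp.single_apply, Pi.single_eq_same, smul_eq_mul, mul_one]
    simpa using hρ

/-- `h` is a lower bound: `h(ρ) ≤ ‖V_y b‖` for every admissible `y`, `‖b‖ ≤ 2`, `|b₀| ≥ ρ`. [cite: Enflo2023, v2 p.11, proof of Lemma 2] -/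
lemma hFun_le (T : H →L[ℂ] H) (hT : ‖T‖ < 1) {u₀ y : H} (hy : y ∈ Adm u₀) {b : ℓ2} (hb : ‖b‖ ≤ 2) {ρ : ℝ}
    (hρ : ρ ≤ ‖b 0‖) : hFun T hT u₀ ρ ≤ ‖V T hT y b‖ :=
  csInf_le ⟨0, hSet_nonneg T hT u₀ ρ⟩ ⟨y, hy, b, hb, hρ, rfl⟩

/-- `h` is non-decreasing on `(−∞, 2]` (the text's "`h(|d|)/|d|` is increasing" is only used through this). [cite: Enflo2023, v2 p.11, proof of Lemma 2] -/
lemma hFun_mono (T : H →L[ℂ] H) (hT : ‖T‖ < 1) {u₀ : H} (hu₀ : ‖u₀‖ = 1) {ρ ρ' : ℝ} (h : ρ ≤ ρ')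
    (hρ' : ρ' ≤ 2) : hFun T hT u₀ ρ ≤ hFun T hT u₀ ρ' := by
  refine csInf_le_csInf ⟨0, hSet_nonneg T hT u₀ ρ⟩ (hSet_nonempty T hT hu₀ hρ') ?_
  rintro r ⟨y, hy, b, hb, hρb, rfl⟩
  exact ⟨y, hy, b, hb, h.trans hρb, rfl⟩

/-- **`h(ρ) > 0` for `0 < ρ ≤ 2`, unless `T` has a non-trivial closed invariant subspace** — the non-constructive
step of the proof of Lemma 2 (v2 p.11 l.8–12), for `T` not surjective (`R(T) ≠ H`, v2 p.1).  Proof: if `h(ρ) = 0`,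
a minimising sequence `(y_n, b_n)` has weakly convergent subsequences `y_n ⇀ y_∞` (`‖y_n‖ ≤ 1`), `b_n ⇀ b_∞` in `ℓ²`
(`‖b_n‖ ≤ 2`); `Re⟨y_∞, u₀⟩ ≥ 3/1000` so `y_∞ ≠ 0`, `|b_{∞,0}| ≥ ρ > 0`, and `⟨z, V_{y_n} b_n⟩ = Σ_j b_{n,j}⟨z, T^j y_n⟩
→ ⟨z, V_{y_∞} b_∞⟩` (Tannery, dominated by `2‖z‖‖T‖^j`), so `V_{y_∞} b_∞ = 0`: the operator `b_∞(T)` kills `y_∞`,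
hence its orbit closure; if `y_∞` is cyclic, `b_∞(T) = 0` and `T` is surjective — contradiction; otherwise `y_∞`
is a non-zero non-cyclic vector. [cite: Enflo2023, v2 p.11, proof of Lemma 2] -/
theorem hFun_pos_or (T : H →L[ℂ] H) (hT : ‖T‖ < 1) {u₀ : H} (hu₀ : ‖u₀‖ = 1)
    (hsurj : ¬ Function.Surjective T) {ρ : ℝ} (hρ : 0 < ρ) (hρ2 : ρ ≤ 2) :
    0 < hFun T hT u₀ ρ ∨ HasNontrivialClosedInvariantSubspace T := by
  by_contra hcon
  push Not at hcon
  obtain ⟨hle, hN⟩ := hcon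
  have h0 : hFun T hT u₀ ρ = 0 := le_antisymm hle (hFun_nonneg T hT u₀ ρ)
  have hne : (hSet T hT u₀ ρ).Nonempty := hSet_nonempty T hT hu₀ hρ2
  -- a minimising sequence
  have hseq : ∀ n : ℕ, ∃ y ∈ Adm u₀, ∃ b : ℓ2, ‖b‖ ≤ 2 ∧ ρ ≤ ‖b 0‖ ∧
      ‖V T hT y b‖ < 1 / ((n : ℝ) + 1) := by
    intro n
    have hlt : sInf (hSet T hT u₀ ρ) < 1 / ((n : ℝ) + 1) := by
      change hFun T hT u₀ ρ < _; rw [h0]; positivity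
    obtain ⟨r, ⟨y, hy, b, hb, hρb, rfl⟩, hr⟩ := exists_lt_of_csInf_lt hne hlt
    exact ⟨y, hy, b, hb, hρb, hr⟩
  choose y hy b hb hρb hsmall using hseq
  -- weakly convergent subsequences: first for `y`, then for `b` along it
  obtain ⟨φ, yinf, hφ, -, hwy⟩ :=
    Literature.Analysis.InnerProduct.exists_strictMono_tendsto_inner_of_norm_le (𝕜 := ℂ) (v := y) (M := 1)
      (fun n => (hy n).1)
  obtain ⟨ψ, binf, hψ, hbinf, hwb⟩ :=
    Literature.Analysis.InnerProduct.exists_strictMono_tendsto_inner_of_norm_le (𝕜 := ℂ) (v := b ∘ φ) (M := 2)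
      (fun n => hb (φ n))
  have hθ : StrictMono (φ ∘ ψ) := hφ.comp hψ
  have hwy' : ∀ z : H, Tendsto (fun n => ⟪z, y (φ (ψ n))⟫_ℂ) atTop (𝓝 ⟪z, yinf⟫_ℂ) := fun z =>
    (hwy z).comp hψ.tendsto_atTop
  -- coordinates of `b` converge along the subsequence
  have hcoord : ∀ j : ℕ, Tendsto (fun n => b (φ (ψ n)) j) atTop (𝓝 (binf j)) := by
    intro j
    have h1 := hwb (lp.single 2 j (1 : ℂ))
    have e : ∀ f : ℓ2, ⟪lp.single 2 j (1 : ℂ), f⟫_ℂ = f j := fun f => by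
      rw [lp.inner_single_left]; simp
    simp only [Function.comp_apply, e] at h1
    exact h1
  -- `|b_∞ 0| ≥ ρ`, so `b_∞ 0 ≠ 0`
  have hb0 : ρ ≤ ‖binf 0‖ :=
    ge_of_tendsto' ((continuous_norm.tendsto _).comp (hcoord 0)) fun n => hρb (φ (ψ n))
  have hb0' : binf 0 ≠ 0 := fun h => by rw [h, norm_zero] at hb0; exact absurd hb0 (not_le.2 hρ)
  -- `y_∞ ≠ 0`
  have hyinf : yinf ≠ 0 := by
    have hlim : Tendsto (fun n => (⟪u₀, y (φ (ψ n))⟫_ℂ).re) atTop (𝓝 (⟪u₀, yinf⟫_ℂ).re) :=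
      (continuous_re.tendsto _).comp (hwy' u₀)
    have hge : (3 / 1000 : ℝ) ≤ (⟪u₀, yinf⟫_ℂ).re := ge_of_tendsto' hlim fun n => (hy (φ (ψ n))).2
    intro h0'
    rw [h0', inner_zero_right, Complex.zero_re] at hge
    norm_num at hge
  -- the key identity `V_{y_∞} b_∞ = 0`, tested against every `z`
  have hV0 : V T hT yinf binf = 0 := by
    refine ext_inner_left ℂ fun z => ?_
    rw [inner_zero_right]
    -- (i) `⟪z, V_{y_n} b_n⟫ → ⟪z, V_{y_∞} b_∞⟫` by Tannery's theorem
    have hT0 : 0 ≤ ‖T‖ := norm_nonneg _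
    have hlim1 : Tendsto (fun n => ⟪z, V T hT (y (φ (ψ n))) (b (φ (ψ n)))⟫_ℂ) atTop
        (𝓝 ⟪z, V T hT yinf binf⟫_ℂ) := by
      simp_rw [inner_V_right]
      refine tendsto_tsum_of_dominated_convergence (bound := fun j => 2 * (‖z‖ * (‖T‖ ^ j * 1)))
        ?_ (fun j => ?_) (Eventually.of_forall fun n j => ?_)
      · exact (((summable_geometric_of_lt_one hT0 hT).mul_right 1).mul_left ‖z‖).mul_left 2
      · refine (hcoord j).mul ?_
        have e : ∀ v : H, ⟪z, (T ^ j) v⟫_ℂ = ⟪ContinuousLinearMap.adjoint (T ^ j) z, v⟫_ℂ := fun v => by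
          rw [ContinuousLinearMap.adjoint_inner_left]
        simp_rw [e]
        exact hwy' _
      · refine (norm_coord_mul_inner_le T _ z _ j).trans ?_
        gcongr
        · exact hb _
        · exact (hy _).1
    -- (ii) the same sequence tends to `0` since `‖V_{y_n} b_n‖ → 0`
    have hlim2 : Tendsto (fun n => ⟪z, V T hT (y (φ (ψ n))) (b (φ (ψ n)))⟫_ℂ) atTop (𝓝 0) := by
      have hbd : ∀ n, ‖⟪z, V T hT (y (φ (ψ n))) (b (φ (ψ n)))⟫_ℂ‖ ≤ ‖z‖ * (1 / ((n : ℝ) + 1)) := by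
        intro n
        refine (norm_inner_le_norm _ _).trans (mul_le_mul_of_nonneg_left ?_ (norm_nonneg _))
        refine (hsmall _).le.trans ?_
        have hn' : n ≤ φ (ψ n) := hθ.id_le n
        have hn : (n : ℝ) ≤ (φ (ψ n) : ℕ) := by exact_mod_cast hn'
        gcongr
      have h0 : Tendsto (fun n : ℕ => 1 / ((n : ℝ) + 1)) atTop (𝓝 (0 : ℝ)) :=
        tendsto_one_div_add_atTop_nhds_zero_nat
      have h1 : Tendsto (fun n : ℕ => ‖z‖ * (1 / ((n : ℝ) + 1))) atTop (𝓝 (0 : ℝ)) := by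
        simpa using h0.const_mul ‖z‖
      exact squeeze_zero_norm hbd h1
    exact tendsto_nhds_unique hlim1 hlim2
  -- conclude
  have hVop : Vop T hT binf yinf = 0 := by rw [Vop_apply]; exact hV0
  rcases isNonCyclic_or_Vop_eq_zero T hT binf hVop with hnc | hzero
  · exact hN (hasNontrivialClosedInvariantSubspace_of_isNonCyclic T hyinf hnc)
  · exact hsurj (surjective_of_Vop_eq_zero T hT binf hb0' hzero)

/-! ## Part 1 — the constants of the proof of Lemma 2 (v2 p.10) -/

/-- `K = 10²⁰` ("Let `K = 10^{20}`", v2 p.10; `‖T‖_op = 1/K`, v2 p.12). [cite: Enflo2023, v2 p.10, proof of Lemma 2] -/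
def bigK : ℝ := (10 : ℝ) ^ 20

/-- `K = 10²⁰ > 1`. [cite: Enflo2023, v2 p.10, proof of Lemma 2] -/
lemma one_lt_bigK : 1 < bigK := by unfold bigK; norm_num

/-- `K = 10²⁰ > 0`. [cite: Enflo2023, v2 p.10, proof of Lemma 2] -/
lemma bigK_pos : 0 < bigK := lt_trans one_pos one_lt_bigK

/-- The paper's `m = [1 + log_K(1/εθ)]` (integer part). [cite: Enflo2023, v2 p.10, proof of Lemma 2] -/
def mIdx (t : ℝ) : ℕ := ⌊1 + Real.logb bigK (1 / t)⌋₊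

/-- The defining property of `m`: `K^{-m} ≤ εθ`. [cite: Enflo2023, v2 p.10, proof of Lemma 2] -/
lemma pow_mIdx_le {t : ℝ} (ht : 0 < t) : (1 / bigK) ^ mIdx t ≤ t := by
  have hK := bigK_pos
  by_cases ht1 : 1 ≤ t
  · calc (1 / bigK) ^ mIdx t ≤ 1 := pow_le_one₀ (by positivity)
          ((div_le_one hK).2 one_lt_bigK.le)
      _ ≤ t := ht1
  · push Not at ht1
    set Lg := Real.logb bigK (1 / t) with hLg
    have hLg0 : 0 ≤ Lg := Real.logb_nonneg one_lt_bigK ((one_le_div ht).2 ht1.le)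
    have hm : Lg ≤ (mIdx t : ℝ) := by
      have h1 : 1 + Lg < (⌊1 + Lg⌋₊ : ℝ) + 1 := Nat.lt_floor_add_one (1 + Lg)
      have : (mIdx t : ℝ) = (⌊1 + Lg⌋₊ : ℝ) := rfl
      linarith
    have hpow : (1 / t) ≤ bigK ^ (mIdx t : ℝ) := by
      calc (1 / t) = bigK ^ Lg := (Real.rpow_logb hK one_lt_bigK.ne' (one_div_pos.2 ht)).symm
        _ ≤ bigK ^ (mIdx t : ℝ) := Real.rpow_le_rpow_of_exponent_le one_lt_bigK.le hm
    rw [Real.rpow_natCast] at hpow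
    rw [one_div_pow, one_div_le (pow_pos hK _) ht]
    exact hpow

omit [CompleteSpace H] in
/-- **First display of the proof of Lemma 2**: `‖T^{m+r} y‖ ≤ εθ · K^{-r}` for `‖T‖ ≤ 1/K`, `‖y‖ ≤ 1`,
`m = [1 + log_K(1/εθ)]`. [cite: Enflo2023, v2 p.10, proof of Lemma 2] -/
theorem norm_pow_mIdx_add_le (T : H →L[ℂ] H) (hTK : ‖T‖ ≤ 1 / bigK) {y : H} (hy : ‖y‖ ≤ 1) {t : ℝ}
    (ht : 0 < t) (r : ℕ) : ‖(T ^ (mIdx t + r)) y‖ ≤ t * (1 / bigK) ^ r := by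
  have hT0 : 0 ≤ ‖T‖ := norm_nonneg _
  have hK1 : (0 : ℝ) ≤ 1 / bigK := (one_div_pos.2 bigK_pos).le
  calc ‖(T ^ (mIdx t + r)) y‖ ≤ ‖T‖ ^ (mIdx t + r) * ‖y‖ := norm_pow_apply_le T _ y
    _ ≤ (1 / bigK) ^ (mIdx t + r) * 1 :=
        mul_le_mul (pow_le_pow_left₀ hT0 hTK _) hy (norm_nonneg _) (pow_nonneg hK1 _)
    _ = (1 / bigK) ^ mIdx t * (1 / bigK) ^ r := by rw [mul_one, pow_add]
    _ ≤ t * (1 / bigK) ^ r := mul_le_mul_of_nonneg_right (pow_mIdx_le ht) (pow_nonneg hK1 _)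

/-- **Second display of the proof of Lemma 2, REPAIRED constant**: if `|⟨T^j y, x₀ − y⟩| ≤ εθ` for all `j ≥ 0`
((9) for the end point `y`), `‖T‖ ≤ 1/K`, `‖y‖ ≤ 1`, `‖x₀ − y‖ ≤ 1`, and `|b_j| ≤ R` for all `j`, then
`|⟨Σ_j b_j T^j y, x₀ − y⟩| ≤ R·(m + 2)·εθ` (split at `j = m`: `m` terms `≤ εθ` each, then the geometric tail
`εθ Σ_r K^{-r} ≤ 2εθ`).  The text prints `(2 log_K(1/εθ))·εθ`; see `printed_pairing_bound_fails`. [cite: Enflo2023, v2 p.10, proof of Lemma 2] -/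
theorem norm_inner_V_le (T : H →L[ℂ] H) (hT : ‖T‖ < 1) (hTK : ‖T‖ ≤ 1 / bigK) {x₀ y : H} (hy : ‖y‖ ≤ 1)
    (hxy : ‖x₀ - y‖ ≤ 1) {t : ℝ} (ht : 0 < t) (h9 : ∀ j : ℕ, ‖⟪x₀ - y, (T ^ j) y⟫_ℂ‖ ≤ t) (b : ℓ2) {R : ℝ}
    (hR : ∀ j, ‖b j‖ ≤ R) : ‖⟪x₀ - y, V T hT y b⟫_ℂ‖ ≤ R * ((mIdx t + 2) * t) := by
  have hR0 : 0 ≤ R := (norm_nonneg _).trans (hR 0)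
  have hT0 : 0 ≤ ‖T‖ := norm_nonneg _
  have hK := bigK_pos
  set m := mIdx t with hm
  -- termwise majorant
  set g : ℕ → ℝ := fun j => ‖b j * ⟪x₀ - y, (T ^ j) y⟫_ℂ‖ with hg
  have hg_le_geom : ∀ j, g j ≤ R * ‖T‖ ^ j := by
    intro j
    calc g j = ‖b j‖ * ‖⟪x₀ - y, (T ^ j) y⟫_ℂ‖ := norm_mul _ _
      _ ≤ R * (‖x₀ - y‖ * (‖T‖ ^ j * ‖y‖)) := by
          refine mul_le_mul (hR j) ?_ (norm_nonneg _) hR0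
          exact (norm_inner_le_norm _ _).trans
            (mul_le_mul_of_nonneg_left (norm_pow_apply_le T j y) (norm_nonneg _))
      _ ≤ R * (1 * (‖T‖ ^ j * 1)) := by gcongr
      _ = R * ‖T‖ ^ j := by ring
  have hg_summ : Summable g :=
    Summable.of_nonneg_of_le (fun j => norm_nonneg _) hg_le_geom
      ((summable_geometric_of_lt_one hT0 hT).mul_left R)
  -- head terms
  have hg_head : ∀ j, g j ≤ R * t := fun j => by
    calc g j = ‖b j‖ * ‖⟪x₀ - y, (T ^ j) y⟫_ℂ‖ := norm_mul _ _
      _ ≤ R * t := mul_le_mul (hR j) (h9 j) (norm_nonneg _) hR0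
  -- tail terms
  have hg_tail : ∀ r, g (r + m) ≤ R * t * (1 / bigK) ^ r := fun r => by
    calc g (r + m) = ‖b (r + m)‖ * ‖⟪x₀ - y, (T ^ (r + m)) y⟫_ℂ‖ := norm_mul _ _
      _ ≤ R * (‖x₀ - y‖ * ‖(T ^ (m + r)) y‖) := by
          rw [add_comm r m]
          exact mul_le_mul (hR _) (norm_inner_le_norm _ _) (norm_nonneg _) hR0
      _ ≤ R * (1 * (t * (1 / bigK) ^ r)) := by
          gcongr
          exact norm_pow_mIdx_add_le T hTK hy ht r
      _ = R * t * (1 / bigK) ^ r := by ring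
  have hq0 : 0 ≤ 1 / bigK := by positivity
  have hq1 : 1 / bigK < 1 := (div_lt_one hK).2 one_lt_bigK
  have hgeomK : HasSum (fun r : ℕ => (1 / bigK) ^ r) (1 - 1 / bigK)⁻¹ := hasSum_geometric_of_lt_one hq0 hq1
  have htail_sum : ∑' r, g (r + m) ≤ R * t * (1 - 1 / bigK)⁻¹ := by
    have hs : Summable fun r => g (r + m) := (summable_nat_add_iff m).2 hg_summ
    calc ∑' r, g (r + m) ≤ ∑' r, R * t * (1 / bigK) ^ r :=
          hs.tsum_le_tsum hg_tail (hgeomK.summable.mul_left _)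
      _ = R * t * (1 - 1 / bigK)⁻¹ := by rw [tsum_mul_left, hgeomK.tsum_eq]
  have hKinv : (1 - 1 / bigK)⁻¹ ≤ 2 := by
    rw [inv_le_comm₀ (by linarith) (by norm_num : (0:ℝ) < 2)]
    have : 1 / bigK ≤ 1 / 2 := by
      rw [one_div_le_one_div hK (by norm_num)]; linarith [one_lt_bigK, show (2:ℝ) ≤ bigK by unfold bigK; norm_num]
    linarith
  have hhead_sum : ∑ j ∈ Finset.range m, g j ≤ m * (R * t) := by
    calc ∑ j ∈ Finset.range m, g j ≤ ∑ j ∈ Finset.range m, R * t := Finset.sum_le_sum fun j _ => hg_head j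
      _ = m * (R * t) := by rw [Finset.sum_const, Finset.card_range, nsmul_eq_mul]
  calc ‖⟪x₀ - y, V T hT y b⟫_ℂ‖ = ‖∑' j, b j * ⟪x₀ - y, (T ^ j) y⟫_ℂ‖ := by rw [inner_V_right]
    _ ≤ ∑' j, g j := norm_tsum_le_tsum_norm hg_summ
    _ = ∑ j ∈ Finset.range m, g j + ∑' r, g (r + m) := (hg_summ.sum_add_tsum_nat_add m).symm
    _ ≤ m * (R * t) + R * t * (1 - 1 / bigK)⁻¹ := add_le_add hhead_sum htail_sum
    _ ≤ m * (R * t) + R * t * 2 := by gcongr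
    _ = R * ((m + 2) * t) := by ring

/-- The arithmetic of the printed constant: `2 log_K(1/εθ) < 1` as soon as `εθ > 10⁻¹⁰ = K^{-1/2}`. [cite: Enflo2023, v2 p.10, proof of Lemma 2] -/
lemma two_mul_logb_lt_one {t : ℝ} (ht : (10 : ℝ) ^ (-(10 : ℤ)) < t) : 2 * Real.logb bigK (1 / t) < 1 := by
  have ht0 : 0 < t := lt_trans (by positivity) ht
  have hK := bigK_pos
  rw [Real.logb, ← lt_div_iff₀' (by norm_num : (0:ℝ) < 2)]
  rw [div_lt_iff₀ (Real.log_pos one_lt_bigK)]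
  -- `log (1/t) < (1/2) log K = log (K^{1/2}) = log 10^10`
  have h10 : (1 / 2) * Real.log bigK = Real.log ((10 : ℝ) ^ 10) := by
    unfold bigK
    rw [Real.log_pow, Real.log_pow]; push_cast; ring
  rw [h10, Real.log_lt_log_iff (one_div_pos.2 ht0) (by positivity)]
  rw [one_div, inv_lt_comm₀ ht0 (by positivity)]
  have ht' : ((10 : ℝ) ^ (10 : ℕ))⁻¹ < t := by rwa [zpow_neg, zpow_ofNat] at ht
  exact ht'

/-- **The printed constant of the second display does not hold**: in the text `εθ = ⟨y₁', x₀ − y₁'⟩` (first line of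
Lemma 2), and with `b = e₀` (`|b_j| ≤ 1`) the left side `|⟨Σ_j b_j T^j y₁', x₀ − y₁'⟩| = |⟨y₁', x₀ − y₁'⟩| ≥ εθ`
exceeds the printed right side `2 log_K(1/εθ)·εθ` whenever `εθ > 10⁻¹⁰` (e.g. on `(10⁻¹⁰, 10⁻⁴]`, inside the range
of Lemma 2).  Harmless for the argument: `norm_inner_V_le` gives the bound with `m + 2` in place of `2 log_K(1/εθ)`.
[cite: Enflo2023, v2 p.10, proof of Lemma 2] -/
theorem printed_pairing_bound_fails (T : H →L[ℂ] H) (hT : ‖T‖ < 1) {x₀ y : H} {t : ℝ}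
    (ht : (10 : ℝ) ^ (-(10 : ℤ)) < t) (h5 : (⟪x₀ - y, y⟫_ℂ).re = t) :
    (∀ j, ‖(lp.single 2 0 (1 : ℂ) : ℓ2) j‖ ≤ 1) ∧
      2 * Real.logb bigK (1 / t) * t < ‖⟪x₀ - y, V T hT y (lp.single 2 0 (1 : ℂ))⟫_ℂ‖ := by
  have ht0 : 0 < t := lt_trans (by positivity) ht
  refine ⟨fun j => ?_, ?_⟩
  · rw [lp.single_apply]
    by_cases hj : 0 = j
    · subst hj; simp
    · rw [Pi.single_eq_of_ne' hj]; simp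
  · rw [V_single, pow_zero, one_apply_eq_self]
    calc 2 * Real.logb bigK (1 / t) * t < 1 * t :=
          mul_lt_mul_of_pos_right (two_mul_logb_lt_one ht) ht0
      _ = (⟪x₀ - y, y⟫_ℂ).re := by rw [one_mul, h5]
      _ ≤ ‖⟪x₀ - y, y⟫_ℂ‖ := Complex.re_le_norm _

/-- **Coefficient bounds from minimality** (v2 p.10 l.-6: "the minimality of `|(1-d)²| + Σ_{j≥1}|c_{1j}|²` … gives
`|c_{1j}| ≤ 2|d|^{1/2}`"): for THE minimal `c` of problem (1) for `V_y` at radius `‖x₀ − y‖` one has `‖c‖ ≤ 1`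
(`e₀` is feasible) and `Σ_{j≥1}|c_j|² = ‖Lc‖² ≤ 1 − |c₀|² ≤ 2|1 − c₀|`. [cite: Enflo2023, v2 p.10, proof of Lemma 2] -/
theorem norm_L_sq_le_two_mul (T : H →L[ℂ] H) (hT : ‖T‖ < 1) {x₀ y : H} {c : ℓ2}
    (hc : IsMinimal (V T hT y) x₀ ‖x₀ - y‖ c) : ‖c‖ ≤ 1 ∧ ‖L c‖ ^ 2 ≤ 2 * ‖1 - c 0‖ := by
  have hc1 : ‖c‖ ≤ 1 := norm_minimal_le_one T hT y x₀ _ c hc le_rfl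
  refine ⟨hc1, ?_⟩
  rw [norm_L_apply_sq]
  have h1 : ‖(1 : ℂ)‖ - ‖c 0‖ ≤ ‖1 - c 0‖ := norm_sub_norm_le _ _
  rw [norm_one] at h1
  have hc2 : ‖c‖ ^ 2 ≤ 1 := by nlinarith [norm_nonneg c]
  have hδ := norm_nonneg (1 - c 0)
  have ha := norm_nonneg (c 0)
  by_cases hδ1 : ‖1 - c 0‖ ≤ 1
  · nlinarith
  · push Not at hδ1
    nlinarith [sq_nonneg ‖c 0‖]

/-- `y − V_y c = V_y (e₀ − c)` — the vector `d y₁' − Σ_{j≥1} c_{1j} T^j y₁'` of the text, `d = 1 − c₀`. [cite: Enflo2023, v2 p.11, proof of Lemma 2] -/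
lemma sub_V_eq (T : H →L[ℂ] H) (hT : ‖T‖ < 1) (y : H) (c : ℓ2) :
    y - V T hT y c = V T hT y (lp.single 2 0 (1 : ℂ) - c) := by
  rw [map_sub, V_single, pow_zero, one_apply_eq_self]

/-- `‖e₀ − c‖ ≤ 2` for `‖c‖ ≤ 1` (the coefficient vector `(d, −c₁, −c₂, …)` of the text lies in the `ℓ²`-ball of radius `2`). [cite: Enflo2023, v2 p.11, proof of Lemma 2] -/
lemma norm_single_sub_le {c : ℓ2} (hc : ‖c‖ ≤ 1) : ‖(lp.single 2 0 (1 : ℂ) : ℓ2) - c‖ ≤ 2 := by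
  calc ‖(lp.single 2 0 (1 : ℂ) : ℓ2) - c‖ ≤ ‖(lp.single 2 0 (1 : ℂ) : ℓ2)‖ + ‖c‖ := norm_sub_le _ _
    _ ≤ 1 + 1 := by
        rw [lp.norm_single (by norm_num : (0 : ℝ≥0∞) < 2), norm_one]; exact add_le_add le_rfl hc
    _ = 2 := by norm_num

/-- The leading coefficient of `e₀ − c` is `d = 1 − c₀`. [cite: Enflo2023, v2 p.11, proof of Lemma 2] -/
lemma single_sub_apply_zero (c : ℓ2) : ((lp.single 2 0 (1 : ℂ) : ℓ2) - c) 0 = 1 - c 0 := by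
  rw [lp.coeFn_sub, Pi.sub_apply, lp.single_apply, Pi.single_eq_same]

/-- **The expansion of `‖x₀ − V_y c‖²` (v2 p.11, last display of the proof) with the repaired pairing bound**:
`‖x₀ − y‖² ≥ ‖x₀ − V_y c‖² = ‖x₀ − y‖² + ‖y − V_y c‖² + 2Re⟨x₀ − y, y − V_y c⟩`, and
`|⟨x₀ − y, y − V_y c⟩| ≤ 2(m+2)εθ` (coefficient vector `e₀ − c`, `‖e₀ − c‖ ≤ 2`), hence
`‖y − V_y c‖² ≤ 4(m+2)εθ`.  This is Lemma 4 with an explicit right-hand side. [cite: Enflo2023, v2 p.11, proof of Lemma 2] -/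
theorem norm_sub_V_sq_le (T : H →L[ℂ] H) (hT : ‖T‖ < 1) (hTK : ‖T‖ ≤ 1 / bigK) {x₀ y : H} (hy : ‖y‖ ≤ 1)
    (hxy : ‖x₀ - y‖ ≤ 1) {t : ℝ} (ht : 0 < t) (h9 : ∀ j : ℕ, ‖⟪x₀ - y, (T ^ j) y⟫_ℂ‖ ≤ t) {c : ℓ2}
    (hc : IsMinimal (V T hT y) x₀ ‖x₀ - y‖ c) : ‖y - V T hT y c‖ ^ 2 ≤ 4 * ((mIdx t + 2) * t) := by
  set w := y - V T hT y c with hw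
  have hfeas : ‖x₀ - V T hT y c‖ ≤ ‖x₀ - y‖ := hc.norm_sub_le
  have hdec : x₀ - V T hT y c = (x₀ - y) + w := by rw [hw]; abel
  have hexp : ‖x₀ - V T hT y c‖ ^ 2 = ‖x₀ - y‖ ^ 2 + 2 * (⟪x₀ - y, w⟫_ℂ).re + ‖w‖ ^ 2 := by
    rw [hdec]; exact @norm_add_sq ℂ _ _ _ _ (x₀ - y) w
  have hsq : ‖x₀ - V T hT y c‖ ^ 2 ≤ ‖x₀ - y‖ ^ 2 := by
    exact pow_le_pow_left₀ (norm_nonneg _) hfeas 2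
  have hcoef := norm_L_sq_le_two_mul T hT hc
  have hpair : ‖⟪x₀ - y, w⟫_ℂ‖ ≤ 2 * ((mIdx t + 2) * t) := by
    rw [hw, sub_V_eq]
    refine norm_inner_V_le T hT hTK hy hxy ht h9 _ fun j => ?_
    exact (lp.norm_apply_le_norm (by norm_num) _ j).trans (norm_single_sub_le hcoef.1)
  have hre : -(⟪x₀ - y, w⟫_ℂ).re ≤ ‖⟪x₀ - y, w⟫_ℂ‖ := by
    have := Complex.abs_re_le_norm ⟪x₀ - y, w⟫_ℂ
    rw [abs_le] at this; linarith [this.1]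
  nlinarith

/-- For admissible `y` the text's `h` is a lower bound for `‖y − V_y c‖`: `h(|d|) ≤ ‖d y − Σ_{j≥1} c_j T^j y‖`,
`d = 1 − c₀`. [cite: Enflo2023, v2 p.11, proof of Lemma 2] -/
theorem hFun_le_norm_sub_V (T : H →L[ℂ] H) (hT : ‖T‖ < 1) {u₀ x₀ y : H} (hyA : y ∈ Adm u₀) {c : ℓ2}
    (hc : IsMinimal (V T hT y) x₀ ‖x₀ - y‖ c) : hFun T hT u₀ ‖1 - c 0‖ ≤ ‖y - V T hT y c‖ := by
  have hcoef := norm_L_sq_le_two_mul T hT hc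
  rw [sub_V_eq]
  refine hFun_le T hT hyA (norm_single_sub_le hcoef.1) ?_
  rw [single_sub_apply_zero]

/-! ## Part 3 — `γ(εθ)`, Lemmas 2–5 as stated, and `γ(εθ) → 0` -/

/-- `β(εθ) := 2[(m+2)εθ]^{1/2}`, the explicit bound of `norm_sub_V_sq_le` (the REPAIRED argument of `h⁻¹`; the
text prints `2[log_K(1/εθ)]^{1/2}`, dropping the factor `εθ`). [cite: Enflo2023, v2 p.11, proof of Lemma 2] -/
def betaEps (t : ℝ) : ℝ := 2 * Real.sqrt ((mIdx t + 2) * t)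

/-- `β(εθ) ≥ 0`. [cite: Enflo2023, v2 p.11, proof of Lemma 2] -/
lemma betaEps_nonneg (t : ℝ) : 0 ≤ betaEps t := by unfold betaEps; positivity

/-- `‖y − V_y c‖ ≤ β(εθ)`. [cite: Enflo2023, v2 p.11, Lemma 4] -/
theorem norm_sub_V_le_betaEps (T : H →L[ℂ] H) (hT : ‖T‖ < 1) (hTK : ‖T‖ ≤ 1 / bigK) {x₀ y : H} (hy : ‖y‖ ≤ 1)
    (hxy : ‖x₀ - y‖ ≤ 1) {t : ℝ} (ht : 0 < t) (h9 : ∀ j : ℕ, ‖⟪x₀ - y, (T ^ j) y⟫_ℂ‖ ≤ t) {c : ℓ2}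
    (hc : IsMinimal (V T hT y) x₀ ‖x₀ - y‖ c) : ‖y - V T hT y c‖ ≤ betaEps t := by
  have h := norm_sub_V_sq_le T hT hTK hy hxy ht h9 hc
  have h' : ‖y - V T hT y c‖ ^ 2 ≤ (betaEps t) ^ 2 := by
    unfold betaEps
    rw [mul_pow, Real.sq_sqrt (by positivity)]
    linarith
  have habs := abs_le_of_sq_le_sq h' (betaEps_nonneg t)
  rwa [abs_of_nonneg (norm_nonneg _)] at habs

/-- The printed argument of `h⁻¹`, `2[log_K(1/εθ)]^{1/2}`, is `≥ 2(1/5)^{1/2} > 0.89` on the whole range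
`0 < εθ ≤ 10⁻⁴` of Lemma 2 (and grows as `εθ → 0`), so with the printed formula `γ(εθ) = h⁻¹(2[log_K(1/εθ)]^{1/2})`
cannot tend to `0`; restoring the dropped factor `εθ` under the root gives `betaEps`, which does. [cite: Enflo2023, v2 p.11, proof of Lemma 2] -/
theorem printed_root_ge {t : ℝ} (ht : 0 < t) (ht4 : t ≤ (10 : ℝ) ^ (-(4 : ℤ))) :
    2 * Real.sqrt (1 / 5) ≤ 2 * Real.sqrt (Real.logb bigK (1 / t)) := by
  gcongr
  -- `logb K (1/t) ≥ logb K 10^4 = 4/20`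
  have hK := bigK_pos
  have ht4' : t ≤ ((10 : ℝ) ^ (4 : ℕ))⁻¹ := by rwa [zpow_neg, zpow_ofNat] at ht4
  have h1 : (10 : ℝ) ^ (4 : ℕ) ≤ 1 / t := by
    rw [le_one_div (by positivity) ht, one_div]
    exact ht4'
  calc (1 / 5 : ℝ) = Real.logb bigK ((10 : ℝ) ^ (4 : ℕ)) := by
        unfold bigK
        rw [Real.logb, Real.log_pow, Real.log_pow]
        have : Real.log 10 ≠ 0 := (Real.log_pos (by norm_num)).ne'
        field_simp
        push_cast; ring
    _ ≤ Real.logb bigK (1 / t) := Real.logb_le_logb_of_le one_lt_bigK (by positivity) h1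

/-- `γ_core(εθ) := sup{ρ ∈ [0,2] : h(ρ) ≤ β(εθ)}` — the text's `h⁻¹(β)`. [cite: Enflo2023, v2 p.11, proof of Lemma 2] -/
def gammaCore (T : H →L[ℂ] H) (hT : ‖T‖ < 1) (u₀ : H) (t : ℝ) : ℝ :=
  sSup {ρ | 0 ≤ ρ ∧ ρ ≤ 2 ∧ hFun T hT u₀ ρ ≤ betaEps t}

/-- `γ_core ≥ 0`. [cite: Enflo2023, v2 p.11, proof of Lemma 2] -/
lemma gammaCore_nonneg (T : H →L[ℂ] H) (hT : ‖T‖ < 1) (u₀ : H) (t : ℝ) : 0 ≤ gammaCore T hT u₀ t :=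
  Real.sSup_nonneg fun _ hρ => hρ.1

/-- `γ_core ≤ 2`. [cite: Enflo2023, v2 p.11, proof of Lemma 2] -/
lemma gammaCore_le_two (T : H →L[ℂ] H) (hT : ‖T‖ < 1) (u₀ : H) (t : ℝ) : gammaCore T hT u₀ t ≤ 2 :=
  Real.sSup_le (fun ρ hρ => hρ.2.1) (by norm_num)

/-- **`γ(εθ) = γ(εθ, u₀, T) := 2γ_core(εθ) + β(εθ)²`** — NON-CONSTRUCTIVE (`γ_core` is the inverse of an infimum over
all admissible vectors; no closed form in `T`, `u₀`): this is the function of Lemmas 2–5. [cite: Enflo2023, v2 p.10, Lemma 2] -/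
def gammaEps (T : H →L[ℂ] H) (hT : ‖T‖ < 1) (u₀ : H) (t : ℝ) : ℝ := 2 * gammaCore T hT u₀ t + betaEps t ^ 2

/-- `γ(εθ) ≥ 0`. [cite: Enflo2023, v2 p.10, Lemma 2] -/
lemma gammaEps_nonneg (T : H →L[ℂ] H) (hT : ‖T‖ < 1) (u₀ : H) (t : ℝ) : 0 ≤ gammaEps T hT u₀ t := by
  unfold gammaEps; nlinarith [gammaCore_nonneg T hT u₀ t, sq_nonneg (betaEps t)]

/-- `β(εθ) ≤ γ(εθ)^{1/2}` (since `γ ≥ β²`). [cite: Enflo2023, v2 p.11, Lemma 4] -/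
lemma betaEps_le_sqrt_gammaEps (T : H →L[ℂ] H) (hT : ‖T‖ < 1) (u₀ : H) (t : ℝ) :
    betaEps t ≤ Real.sqrt (gammaEps T hT u₀ t) := by
  rw [Real.le_sqrt (betaEps_nonneg t) (gammaEps_nonneg T hT u₀ t)]
  unfold gammaEps; nlinarith [gammaCore_nonneg T hT u₀ t]

/-- `|d| = |1 − c₀| ≤ γ_core(εθ)` for admissible `y` (`|d|` belongs to the set whose supremum is `γ_core`). [cite: Enflo2023, v2 p.11, proof of Lemma 2] -/
theorem norm_one_sub_le_gammaCore (T : H →L[ℂ] H) (hT : ‖T‖ < 1) (hTK : ‖T‖ ≤ 1 / bigK) {u₀ x₀ y : H}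
    (hyA : y ∈ Adm u₀) (hxy : ‖x₀ - y‖ ≤ 1) {t : ℝ} (ht : 0 < t) (h9 : ∀ j : ℕ, ‖⟪x₀ - y, (T ^ j) y⟫_ℂ‖ ≤ t)
    {c : ℓ2} (hc : IsMinimal (V T hT y) x₀ ‖x₀ - y‖ c) : ‖1 - c 0‖ ≤ gammaCore T hT u₀ t := by
  have hcoef := norm_L_sq_le_two_mul T hT hc
  have hc0 : ‖c 0‖ ≤ 1 := (lp.norm_apply_le_norm (by norm_num) c 0).trans hcoef.1
  refine le_csSup ⟨2, fun ρ hρ => hρ.2.1⟩ ⟨norm_nonneg _, ?_, ?_⟩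
  · calc ‖1 - c 0‖ ≤ ‖(1 : ℂ)‖ + ‖c 0‖ := norm_sub_le _ _
      _ ≤ 2 := by rw [norm_one]; linarith
  · exact (hFun_le_norm_sub_V T hT hyA hc).trans (norm_sub_V_le_betaEps T hT hTK hyA.1 hxy ht h9 hc)

/-- **LEMMA 2 (v2 p.10), typed**: in the situation of Lemma 2 — `‖T‖ ≤ 10⁻²⁰`, `y` admissible
(`‖y‖ ≤ 1`, `Re⟨y,u₀⟩ ≥ 3/1000`), `‖x₀ − y‖ ≤ 1`, `|⟨T^j y, x₀ − y⟩| ≤ εθ` for all `j` ((9)), `0 < εθ`, and `c` THE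
minimal solution of (1) for `V_y` at radius `‖x₀ − y‖` — the leading coefficient dominates:
`|c₀|² ≥ 1 − γ(εθ)` (the text: `a₀² ≥ [1 − γ(εθ)]`) and `Σ_{j≥1}|c_j|² ≤ γ(εθ)`. [cite: Enflo2023, v2 p.10, Lemma 2] -/
theorem lemma2_coeff (T : H →L[ℂ] H) (hT : ‖T‖ < 1) (hTK : ‖T‖ ≤ 1 / bigK) {u₀ x₀ y : H} (hyA : y ∈ Adm u₀)
    (hxy : ‖x₀ - y‖ ≤ 1) {t : ℝ} (ht : 0 < t) (h9 : ∀ j : ℕ, ‖⟪x₀ - y, (T ^ j) y⟫_ℂ‖ ≤ t) {c : ℓ2}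
    (hc : IsMinimal (V T hT y) x₀ ‖x₀ - y‖ c) :
    1 - gammaEps T hT u₀ t ≤ ‖c 0‖ ^ 2 ∧ ‖L c‖ ^ 2 ≤ gammaEps T hT u₀ t := by
  have hd := norm_one_sub_le_gammaCore T hT hTK hyA hxy ht h9 hc
  have hcoef := norm_L_sq_le_two_mul T hT hc
  have h1 : ‖(1 : ℂ)‖ - ‖c 0‖ ≤ ‖1 - c 0‖ := norm_sub_norm_le _ _
  rw [norm_one] at h1
  have hβ := sq_nonneg (betaEps t)
  have hg : gammaEps T hT u₀ t = 2 * gammaCore T hT u₀ t + betaEps t ^ 2 := rfl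
  constructor
  · by_cases hgc : gammaCore T hT u₀ t ≤ 1
    · have : 1 - gammaCore T hT u₀ t ≤ ‖c 0‖ := by linarith
      nlinarith [gammaCore_nonneg T hT u₀ t]
    · push Not at hgc; nlinarith [sq_nonneg ‖c 0‖]
  · linarith [hcoef.2]

/-- The shape of (22) for the renormalised coefficients: once `γ(εθ) ≤ 1/101`, Lemma 2 gives
`|c₀|² ≥ 100·Σ_{j≥1}|c_j|²` (v2 p.8 (22): "the leading coefficient dominates"). [cite: Enflo2023, v2 p.10, Lemma 2] -/
theorem lemma2_coeff_ratio (T : H →L[ℂ] H) (hT : ‖T‖ < 1) (hTK : ‖T‖ ≤ 1 / bigK) {u₀ x₀ y : H}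
    (hyA : y ∈ Adm u₀) (hxy : ‖x₀ - y‖ ≤ 1) {t : ℝ} (ht : 0 < t) (h9 : ∀ j : ℕ, ‖⟪x₀ - y, (T ^ j) y⟫_ℂ‖ ≤ t)
    {c : ℓ2} (hc : IsMinimal (V T hT y) x₀ ‖x₀ - y‖ c) (hγ : gammaEps T hT u₀ t ≤ 1 / 101) :
    100 * ‖L c‖ ^ 2 ≤ ‖c 0‖ ^ 2 := by
  have h := lemma2_coeff T hT hTK hyA hxy ht h9 hc
  nlinarith [h.1, h.2]

/-- **LEMMA 4 (v2 p.11), typed**: `‖y₁' − Σ_j c_j T^j y₁'‖ ≤ γ(εθ)^{1/2}` (indeed `≤ β(εθ) = 2[(m+2)εθ]^{1/2}`,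
`norm_sub_V_le_betaEps`; no admissibility needed for that explicit form). [cite: Enflo2023, v2 p.11, Lemma 4] -/
theorem lemma4_move (T : H →L[ℂ] H) (hT : ‖T‖ < 1) (hTK : ‖T‖ ≤ 1 / bigK) (u₀ : H) {x₀ y : H} (hy : ‖y‖ ≤ 1)
    (hxy : ‖x₀ - y‖ ≤ 1) {t : ℝ} (ht : 0 < t) (h9 : ∀ j : ℕ, ‖⟪x₀ - y, (T ^ j) y⟫_ℂ‖ ≤ t) {c : ℓ2}
    (hc : IsMinimal (V T hT y) x₀ ‖x₀ - y‖ c) : ‖y - V T hT y c‖ ≤ Real.sqrt (gammaEps T hT u₀ t) :=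
  (norm_sub_V_le_betaEps T hT hTK hy hxy ht h9 hc).trans (betaEps_le_sqrt_gammaEps T hT u₀ t)

omit [CompleteSpace H] in
/-- The `εθ`-update behind Lemmas 3/5: `Re⟨y₂, x₀ − y₂⟩ ≤ Re⟨y, x₀ − y⟩ + 2‖y₂ − y‖` when `‖x₀ − y₂‖ ≤ 1`,
`‖y‖ ≤ 1` (`⟨y₂, x₀−y₂⟩ − ⟨y, x₀−y⟩ = ⟨y₂ − y, x₀ − y₂⟩ + ⟨y, y − y₂⟩`). [folklore] -/
lemma re_inner_update {x₀ y y₂ : H} (hy : ‖y‖ ≤ 1) (hx : ‖x₀ - y₂‖ ≤ 1) :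
    (⟪x₀ - y₂, y₂⟫_ℂ).re ≤ (⟪x₀ - y, y⟫_ℂ).re + 2 * ‖y - y₂‖ := by
  have hid : ⟪x₀ - y₂, y₂⟫_ℂ = ⟪x₀ - y, y⟫_ℂ + (⟪x₀ - y₂, y₂ - y⟫_ℂ + ⟪y - y₂, y⟫_ℂ) := by
    simp only [inner_sub_left, inner_sub_right]; ring
  rw [hid, Complex.add_re, Complex.add_re]
  have e1 : (⟪x₀ - y₂, y₂ - y⟫_ℂ).re ≤ ‖x₀ - y₂‖ * ‖y₂ - y‖ :=
    (Complex.re_le_norm _).trans (norm_inner_le_norm _ _)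
  have e2 : (⟪y - y₂, y⟫_ℂ).re ≤ ‖y - y₂‖ * ‖y‖ :=
    (Complex.re_le_norm _).trans (norm_inner_le_norm _ _)
  have e3 : ‖x₀ - y₂‖ * ‖y₂ - y‖ ≤ 1 * ‖y₂ - y‖ := mul_le_mul_of_nonneg_right hx (norm_nonneg _)
  have e4 : ‖y - y₂‖ * ‖y‖ ≤ ‖y - y₂‖ * 1 := mul_le_mul_of_nonneg_left hy (norm_nonneg _)
  rw [norm_sub_rev y₂ y] at e1 e3
  linarith

/-- **LEMMA 3 = LEMMA 5 (v2 p.10–11; the two displays are verbatim identical), typed**: the new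
`εθ' = Re⟨Σ_j c_j T^j y₁', x₀ − Σ_j c_j T^j y₁'⟩` satisfies `εθ' ≤ εθ + 2β(εθ) ≤ 3γ(εθ)^{1/2}` (for `εθ ≤ 8`, which
covers the text's `εθ ≤ 10⁻⁴`; `εθ ≤ γ^{1/2}` because `γ ≥ β² = 4(m+2)εθ ≥ εθ²`). [cite: Enflo2023, v2 p.10, Lemma 3] -/
theorem lemma3_etheta (T : H →L[ℂ] H) (hT : ‖T‖ < 1) (hTK : ‖T‖ ≤ 1 / bigK) (u₀ : H) {x₀ y : H} (hy : ‖y‖ ≤ 1)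
    (hxy : ‖x₀ - y‖ ≤ 1) {t : ℝ} (ht : 0 < t) (ht8 : t ≤ 8) (h9 : ∀ j : ℕ, ‖⟪x₀ - y, (T ^ j) y⟫_ℂ‖ ≤ t)
    {c : ℓ2} (hc : IsMinimal (V T hT y) x₀ ‖x₀ - y‖ c) :
    (⟪x₀ - V T hT y c, V T hT y c⟫_ℂ).re ≤ 3 * Real.sqrt (gammaEps T hT u₀ t) := by
  have hw := norm_sub_V_le_betaEps T hT hTK hy hxy ht h9 hc
  have hβγ := betaEps_le_sqrt_gammaEps T hT u₀ t
  have hx2 : ‖x₀ - V T hT y c‖ ≤ 1 := hc.norm_sub_le.trans hxy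
  have hup := re_inner_update (x₀ := x₀) hy hx2
  have h0 : (⟪x₀ - y, y⟫_ℂ).re ≤ t := by
    have := h9 0
    rw [pow_zero, one_apply_eq_self] at this
    exact (Complex.re_le_norm _).trans this
  -- `t ≤ β(t) ^ 2 / ... `: `t² ≤ 4(m+2)t` since `t ≤ 8 ≤ 4(m+2)`
  have htβ : t ≤ betaEps t := by
    have hsq : t ^ 2 ≤ (betaEps t) ^ 2 := by
      unfold betaEps
      rw [mul_pow, Real.sq_sqrt (by positivity)]
      have : (0:ℝ) ≤ (mIdx t : ℝ) := Nat.cast_nonneg _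
      nlinarith
    exact pow_le_pow_iff_left₀ ht.le (betaEps_nonneg t) two_ne_zero |>.1 hsq
  linarith

/-! ### `γ(εθ) → 0` as `εθ → 0⁺` (unless `T` has a non-trivial closed invariant subspace) -/

/-- Elementary majorant: `(m + 2)εθ ≤ 3εθ + 2εθ^{1/2}/log K` for `0 < εθ ≤ 1`
(`m ≤ 1 + log_K(1/εθ)` and `log(1/εθ) = 2 log(εθ^{-1/2}) ≤ 2εθ^{-1/2}`). [folklore] -/
lemma mIdx_mul_le {t : ℝ} (ht : 0 < t) (ht1 : t ≤ 1) :
    ((mIdx t : ℝ) + 2) * t ≤ 3 * t + 2 * Real.sqrt t / Real.log bigK := by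
  have hK := bigK_pos
  have hlogK : 0 < Real.log bigK := Real.log_pos one_lt_bigK
  have hLg0 : 0 ≤ Real.logb bigK (1 / t) := Real.logb_nonneg one_lt_bigK ((one_le_div ht).2 ht1)
  have hm : (mIdx t : ℝ) ≤ 1 + Real.logb bigK (1 / t) := Nat.floor_le (by linarith)
  -- `log (1/t) ≤ 2 / sqrt t`
  have hst : 0 < Real.sqrt t := Real.sqrt_pos.2 ht
  have hlog : Real.log (1 / t) ≤ 2 / Real.sqrt t := by
    have e : (1 / t) = (1 / Real.sqrt t) ^ 2 := by
      rw [div_pow, one_pow, Real.sq_sqrt ht.le]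
    rw [e, Real.log_pow, Nat.cast_ofNat]
    have := Real.log_le_sub_one_of_pos (one_div_pos.2 hst)
    have h2 : Real.log (1 / Real.sqrt t) ≤ 1 / Real.sqrt t := by linarith [one_div_pos.2 hst]
    calc 2 * Real.log (1 / Real.sqrt t) ≤ 2 * (1 / Real.sqrt t) := by linarith
      _ = 2 / Real.sqrt t := by ring
  have hlogb : Real.logb bigK (1 / t) ≤ 2 / Real.sqrt t / Real.log bigK := by
    rw [Real.logb]; exact div_le_div_of_nonneg_right hlog hlogK.le
  have hkey : Real.logb bigK (1 / t) * t ≤ 2 * Real.sqrt t / Real.log bigK := by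
    calc Real.logb bigK (1 / t) * t ≤ (2 / Real.sqrt t / Real.log bigK) * t :=
          mul_le_mul_of_nonneg_right hlogb ht.le
      _ = 2 * Real.sqrt t / Real.log bigK := by
          field_simp
          rw [← Real.sqrt_mul_self ht.le]
          rw [Real.sqrt_mul_self ht.le]
          nlinarith [Real.mul_self_sqrt ht.le, Real.sq_sqrt ht.le]
  nlinarith

/-- `β(εθ) → 0` as `εθ → 0⁺`. [folklore] -/
lemma tendsto_betaEps : Tendsto betaEps (𝓝[>] 0) (𝓝 0) := by
  have hlogK : 0 < Real.log bigK := Real.log_pos one_lt_bigK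
  -- majorant `g t = 3 t + 2 sqrt t / log K → 0`
  have hg : Tendsto (fun t : ℝ => 3 * t + 2 * Real.sqrt t / Real.log bigK) (𝓝[>] 0) (𝓝 0) := by
    have h1 : Tendsto (fun t : ℝ => 3 * t + 2 * Real.sqrt t / Real.log bigK) (𝓝 0) (𝓝 0) := by
      have hc : Continuous fun t : ℝ => 3 * t + 2 * Real.sqrt t / Real.log bigK := by
        continuity
      simpa using hc.tendsto 0
    exact h1.mono_left nhdsWithin_le_nhds
  have hinner : Tendsto (fun t : ℝ => ((mIdx t : ℝ) + 2) * t) (𝓝[>] 0) (𝓝 0) := by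
    refine squeeze_zero' ?_ ?_ hg
    · filter_upwards [self_mem_nhdsWithin] with t ht
      exact mul_nonneg (by positivity) (le_of_lt ht)
    · have hmem : Set.Ioc (0 : ℝ) 1 ∈ 𝓝[>] (0 : ℝ) := Ioc_mem_nhdsGT one_pos
      filter_upwards [hmem] with t ht
      exact mIdx_mul_le ht.1 ht.2
  have hsqrt : Tendsto (fun t : ℝ => Real.sqrt (((mIdx t : ℝ) + 2) * t)) (𝓝[>] 0) (𝓝 0) := by
    have := (Real.continuous_sqrt.tendsto 0).comp hinner
    rw [Real.sqrt_zero] at this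
    exact this
  have h2 := hsqrt.const_mul 2
  rw [mul_zero] at h2
  change Tendsto (fun t : ℝ => 2 * Real.sqrt (((mIdx t : ℝ) + 2) * t)) (𝓝[>] 0) (𝓝 0)
  exact h2

/-- **`γ(εθ) → 0` as `εθ → 0⁺`, OR `T` has a non-trivial closed invariant subspace** (for `T` not surjective and a
unit vector `u₀`): the content of "`γ(εθ) → 0` as `(εθ) → 0`" in Lemma 2, v2 p.10, resting on `hFun_pos_or`.
Given `ρ₀ ∈ (0,2]`, `h(ρ₀) > 0`; once `β(εθ) < h(ρ₀)`, every `ρ ≤ 2` with `h(ρ) ≤ β(εθ)` is `< ρ₀` (`h` monotone), so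
`γ_core(εθ) ≤ ρ₀`. [cite: Enflo2023, v2 p.10, Lemma 2] -/
theorem gammaEps_tendsto_zero_or (T : H →L[ℂ] H) (hT : ‖T‖ < 1) {u₀ : H} (hu₀ : ‖u₀‖ = 1)
    (hsurj : ¬ Function.Surjective T) :
    HasNontrivialClosedInvariantSubspace T ∨ Tendsto (gammaEps T hT u₀) (𝓝[>] 0) (𝓝 0) := by
  by_cases hN : HasNontrivialClosedInvariantSubspace T
  · exact Or.inl hN
  right
  have hpos : ∀ ρ, 0 < ρ → ρ ≤ 2 → 0 < hFun T hT u₀ ρ := fun ρ h1 h2 =>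
    (hFun_pos_or T hT hu₀ hsurj h1 h2).resolve_right hN
  -- `γ_core → 0`
  have hcore : Tendsto (gammaCore T hT u₀) (𝓝[>] 0) (𝓝 0) := by
    rw [Metric.tendsto_nhds]
    intro ε hε
    set ρ₀ := min (ε / 2) 2 with hρ₀
    have hρ₀pos : 0 < ρ₀ := lt_min (half_pos hε) two_pos
    have hρ₀2 : ρ₀ ≤ 2 := min_le_right _ _
    have hh0 : 0 < hFun T hT u₀ ρ₀ := hpos ρ₀ hρ₀pos hρ₀2
    have hev : ∀ᶠ t in 𝓝[>] (0 : ℝ), betaEps t < hFun T hT u₀ ρ₀ :=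
      (tendsto_order.1 tendsto_betaEps).2 _ hh0
    filter_upwards [hev] with t ht
    have hle : gammaCore T hT u₀ t ≤ ρ₀ := by
      refine Real.sSup_le (fun ρ hρ => ?_) hρ₀pos.le
      obtain ⟨hρ0, hρ2, hρh⟩ := hρ
      by_contra hcon
      push Not at hcon
      have := hFun_mono T hT hu₀ hcon.le hρ2
      linarith
    rw [Real.dist_eq, sub_zero, abs_of_nonneg (gammaCore_nonneg T hT u₀ t)]
    calc gammaCore T hT u₀ t ≤ ρ₀ := hle
      _ ≤ ε / 2 := min_le_left _ _
      _ < ε := half_lt_self hε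
  have hb2 : Tendsto (fun t => betaEps t ^ 2) (𝓝[>] 0) (𝓝 0) := by
    have := tendsto_betaEps.pow 2
    rwa [zero_pow two_ne_zero] at this
  have h := (hcore.const_mul 2).add hb2
  rw [mul_zero, zero_add] at h
  change Tendsto (fun t => 2 * gammaCore T hT u₀ t + betaEps t ^ 2) (𝓝[>] 0) (𝓝 0)
  exact h

end Lemma2

end Literature.Analysis.OperatorTheory.Enflo2023

end
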